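import Mathlib
import Summits.Ventures.HodgeRepro.Tier4.Common.AdelicDefs
import Summits.Ventures.HodgeRepro.Tier4.Line1.PlaneDefs
import Summits.Ventures.HodgeRepro.Tier4.Line1.AdelicParts
import Summits.Ventures.HodgeRepro.Tier4.Line4.LineScalars

/-!
# Tier4/Line4/RationalLineScalars — the RATIONAL `E′`-scalars `x + yΩ`, their norm, and the rational torus elements

Blind re-derivation cell `pub-hodge-repro`, Tier 4 «PROVE THE STEP» (README §9–§10), LINE L4, cut C-L4-TAIL (S2′)(ii)
— the FIBRE BOUND (lead S14985; TAKEN S14993), seat t4-L2-p3 (gen 4); module 1 (the rational scalar calculus, the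
`k`-level twin of LineScalars' adelic `esc`/`nrm`).

* `escK x y = x·1 + y·Ω` (rational `E′`-scalars), `nrmK d x y = x² + d y²`: products, conjugates
  (`escK_mul_escK_conj`), commutation with `Ω`-commuting matrices, the row action `v ᵥ* escK x y = x v + y (vΩ)`,
  the unitarity `escK x y · B · (escK x y)ᵀ = nrmK · B` (`ΩB = −BΩᵀ`), inverses of non-zero-norm scalars
  (`escK_mul_escK_inv`), and HILBERT 90 for the norm-one group: two scalars of the same non-zero norm differ by a
  norm-one scalar (`exists_nrmK_one_mul_eq`);
* **`torusMatK P u v = escK u₀ v₀ P₀ + escK u₁ v₁ P₁`** for a complementary pair of `B`-self-adjoint `E′`-line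
  projectors: commutes with `Ω` and the `P_i`, is unitary when both scalars have norm one
  (`torusMatK_mul_B_mul_transpose`), has the conjugate inverse, and **`torusPtK`** is the corresponding RATIONAL
  POINT of `U(W)(𝔸)` (`GA.ofRationalMat`), in the torus of the projectors (`torusPtK_mem_torusT`,
  `torusPtK_mem_torusT'`).

Mathlib + the line's landed modules only; no printed input; nothing here asserts anything about the truth of (P);
HC_CM is NOT proved by anyone in this repository.
-/

set_option autoImplicit false

noncomputable section

namespace Summit.Ventures.HodgeRepro.Tier4.Line4

open Summit.Ventures.HodgeRepro.Tier4 Summit.Ventures.HodgeRepro.Tier4.Common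
  Summit.Ventures.HodgeRepro.Tier4.Line1 Matrix NumberField
open scoped NumberField

/-! ## 1. Rational `E′`-scalars -/

section Scalars

variable {k : Type} [Field k] (W : PlaneData k)

/-- the rational `E′`-scalar `x · 1 + y · Ω` -/
def escK (x y : k) : Matrix (Fin 4) (Fin 4) k := x • (1 : Matrix (Fin 4) (Fin 4) k) + y • W.Ω

/-- the norm `x² + d y²` of `x + yΩ` -/
def nrmK (d x y : k) : k := x * x + d * (y * y)

/-- the product of two rational scalars -/
theorem escK_mul_escK {d : k} (hΩ : W.Ω * W.Ω = -(d • (1 : Matrix (Fin 4) (Fin 4) k))) (x y x' y' : k) :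
    escK W x y * escK W x' y' = escK W (x * x' - d * (y * y')) (x * y' + y * x') := by
  simp only [escK, add_mul, mul_add, smul_mul_assoc, mul_smul_comm, one_mul, mul_one, hΩ]
  module

/-- `(x + yΩ)(x − yΩ) = nrmK · 1` -/
theorem escK_mul_escK_conj {d : k} (hΩ : W.Ω * W.Ω = -(d • (1 : Matrix (Fin 4) (Fin 4) k))) (x y : k) :
    escK W x y * escK W x (-y) = nrmK d x y • (1 : Matrix (Fin 4) (Fin 4) k) := by
  rw [escK_mul_escK W hΩ]
  have h2 : x * x - d * (y * -y) = nrmK d x y := by simp only [nrmK]; ring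
  have h3 : x * -y + y * x = 0 := by ring
  rw [h2, h3]
  simp [escK]

/-- scalars commute -/
theorem escK_comm {d : k} (hΩ : W.Ω * W.Ω = -(d • (1 : Matrix (Fin 4) (Fin 4) k))) (x y x' y' : k) :
    escK W x y * escK W x' y' = escK W x' y' * escK W x y := by
  rw [escK_mul_escK W hΩ, escK_mul_escK W hΩ]
  congr 1 <;> ring

/-- a scalar commutes with every matrix commuting with `Ω` -/
theorem escK_mul_comm (x y : k) {A : Matrix (Fin 4) (Fin 4) k} (hA : A * W.Ω = W.Ω * A) :
    escK W x y * A = A * escK W x y := by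
  simp only [escK, add_mul, mul_add, smul_mul_assoc, mul_smul_comm, one_mul, mul_one, hA]

/-- the transpose of a scalar -/
theorem escK_transpose (x y : k) : (escK W x y)ᵀ = x • (1 : Matrix (Fin 4) (Fin 4) k) + y • W.Ωᵀ := by
  simp only [escK, transpose_add, transpose_smul, transpose_one]

/-- **unitarity of a scalar**: `(x + yΩ) B (x + yΩ)ᵀ = (x² + d y²) B` (from `ΩB = −BΩᵀ`, `Ω² = −d`). -/
theorem escK_mul_B_mul_transpose {d : k} (hΩ : W.Ω * W.Ω = -(d • (1 : Matrix (Fin 4) (Fin 4) k)))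
    (hΩB : W.Ω * W.B = -(W.B * W.Ωᵀ)) (x y : k) :
    escK W x y * W.B * (escK W x y)ᵀ = nrmK d x y • W.B := by
  have hΩBΩ : W.Ω * W.B * W.Ωᵀ = d • W.B := by
    rw [hΩB, neg_mul, Matrix.mul_assoc, ← transpose_mul, hΩ]
    simp only [transpose_neg, transpose_smul, transpose_one, mul_neg, Matrix.mul_smul, Matrix.mul_one, neg_neg]
  rw [escK_transpose]
  simp only [escK, nrmK, add_mul, mul_add, smul_mul_assoc, mul_smul_comm, one_mul, mul_one, Matrix.mul_assoc]
  rw [← Matrix.mul_assoc W.Ω W.B W.Ωᵀ, hΩBΩ, hΩB]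
  module

/-- the row action of a scalar: `v (x + yΩ) = x v + y (vΩ)` -/
theorem vecMul_escK (x y : k) (v : Fin 4 → k) : v ᵥ* escK W x y = x • v + y • (v ᵥ* W.Ω) := by
  simp only [escK, vecMul_add, vecMul_smul, vecMul_one]

/-- the inverse of a scalar of non-zero norm: `(x + yΩ)(x/n − (y/n)Ω) = 1` -/
theorem escK_mul_escK_inv {d : k} (hΩ : W.Ω * W.Ω = -(d • (1 : Matrix (Fin 4) (Fin 4) k))) {x y : k}
    (hn : nrmK d x y ≠ 0) : escK W x y * escK W (x / nrmK d x y) (-(y / nrmK d x y)) = 1 := by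
  rw [escK_mul_escK W hΩ]
  have h1 : x * (x / nrmK d x y) - d * (y * -(y / nrmK d x y)) = 1 := by
    field_simp
    simp only [nrmK]
    ring
  have h2 : x * -(y / nrmK d x y) + y * (x / nrmK d x y) = 0 := by
    field_simp
    ring
  rw [h1, h2]
  simp [escK]

/-- the norm is multiplicative -/
theorem nrmK_mul (d x y x' y' : k) :
    nrmK d (x * x' - d * (y * y')) (x * y' + y * x') = nrmK d x y * nrmK d x' y' := by
  simp only [nrmK]
  ring

/-- **Hilbert 90 for the norm-one group**: two scalars of the same non-zero norm differ by a norm-one scalar,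
`x' + y'Ω = (u + vΩ)(x + yΩ)` with `u² + d v² = 1`. -/
theorem exists_nrmK_one_mul_eq {d : k} (hΩ : W.Ω * W.Ω = -(d • (1 : Matrix (Fin 4) (Fin 4) k))) {x y x' y' : k}
    (hn : nrmK d x y ≠ 0) (h : nrmK d x' y' = nrmK d x y) :
    ∃ u v : k, nrmK d u v = 1 ∧ escK W x' y' = escK W u v * escK W x y := by
  refine ⟨(x' * x + d * (y' * y)) / nrmK d x y, (y' * x - x' * y) / nrmK d x y, ?_, ?_⟩
  · -- the norm of the quotient is `nrmK x' y' · nrmK x y / (nrmK x y)² = 1`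
    have hAB : nrmK d (x' * x + d * (y' * y)) (y' * x - x' * y) = nrmK d x' y' * nrmK d x y := by
      simp only [nrmK]; ring
    have e : nrmK d ((x' * x + d * (y' * y)) / nrmK d x y) ((y' * x - x' * y) / nrmK d x y) =
        nrmK d (x' * x + d * (y' * y)) (y' * x - x' * y) / (nrmK d x y * nrmK d x y) := by
      simp only [nrmK]
      rw [div_mul_div_comm, div_mul_div_comm, ← mul_div_assoc, ← add_div]
    rw [e, hAB, h, div_self (mul_ne_zero hn hn)]
  · -- `(x' + y'Ω)(x − yΩ) = (x' x + d y' y) + (y' x − x' y)Ω`, then divide by the norm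
    have hinv := escK_mul_escK_inv W hΩ hn
    calc escK W x' y' = escK W x' y' * (escK W x y * escK W (x / nrmK d x y) (-(y / nrmK d x y))) := by
          rw [hinv, Matrix.mul_one]
      _ = escK W x' y' * escK W (x / nrmK d x y) (-(y / nrmK d x y)) * escK W x y := by
          rw [escK_comm W hΩ x y, Matrix.mul_assoc]
      _ = escK W ((x' * x + d * (y' * y)) / nrmK d x y) ((y' * x - x' * y) / nrmK d x y) * escK W x y := by
          rw [escK_mul_escK W hΩ]
          congr 2 <;> field_simp <;> ring

end Scalars

/-! ## 2. The rational torus elements `escK u₀ v₀ P₀ + escK u₁ v₁ P₁` -/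

section Torus

variable {k : Type} [Field k] (W : PlaneData k)

/-- the rational matrix with scalar `u_i + v_i Ω` on the line `P_i` -/
def torusMatK (P : Fin 2 → Matrix (Fin 4) (Fin 4) k) (u v : Fin 2 → k) : Matrix (Fin 4) (Fin 4) k :=
  escK W (u 0) (v 0) * P 0 + escK W (u 1) (v 1) * P 1

/-- `torusMatK` commutes with `Ω` -/
theorem torusMatK_mul_Omega (P : Fin 2 → Matrix (Fin 4) (Fin 4) k) (hPΩ : ∀ i, P i * W.Ω = W.Ω * P i)
    (u v : Fin 2 → k) : torusMatK W P u v * W.Ω = W.Ω * torusMatK W P u v := by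
  have h : ∀ x y, escK W x y * W.Ω = W.Ω * escK W x y := fun x y => escK_mul_comm W x y rfl
  simp only [torusMatK, add_mul, mul_add]
  calc escK W (u 0) (v 0) * P 0 * W.Ω + escK W (u 1) (v 1) * P 1 * W.Ω
      = escK W (u 0) (v 0) * (P 0 * W.Ω) + escK W (u 1) (v 1) * (P 1 * W.Ω) := by simp only [Matrix.mul_assoc]
    _ = escK W (u 0) (v 0) * W.Ω * P 0 + escK W (u 1) (v 1) * W.Ω * P 1 := by
        rw [hPΩ 0, hPΩ 1]; simp only [Matrix.mul_assoc]
    _ = W.Ω * escK W (u 0) (v 0) * P 0 + W.Ω * escK W (u 1) (v 1) * P 1 := by rw [h, h]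
    _ = W.Ω * (escK W (u 0) (v 0) * P 0) + W.Ω * (escK W (u 1) (v 1) * P 1) := by simp only [Matrix.mul_assoc]

/-- `torusMatK` commutes with each projector -/
theorem torusMatK_mul_P (P : Fin 2 → Matrix (Fin 4) (Fin 4) k) (hPΩ : ∀ i, P i * W.Ω = W.Ω * P i)
    (hPi : ∀ i, P i * P i = P i) (hPs : P 0 + P 1 = 1) (u v : Fin 2 → k) (i : Fin 2) :
    torusMatK W P u v * P i = P i * torusMatK W P u v := by
  have h : ∀ x y i, escK W x y * P i = P i * escK W x y := fun x y i => escK_mul_comm W x y (hPΩ i)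
  have h01 : P 0 * P 1 = 0 := mul_eq_zero_of_ne P hPi hPs (by decide)
  have h10 : P 1 * P 0 = 0 := mul_eq_zero_of_ne P hPi hPs (by decide)
  simp only [torusMatK, add_mul, mul_add, Matrix.mul_assoc]
  rw [← Matrix.mul_assoc (P i) (escK W (u 0) (v 0)), ← h, ← Matrix.mul_assoc (P i) (escK W (u 1) (v 1)), ← h,
    Matrix.mul_assoc, Matrix.mul_assoc]
  fin_cases i <;> simp [hPi, h01, h10]

/-- **unitarity of a torus element with norm-one scalars**: `D B Dᵀ = B` for `D = escK u₀ v₀ P₀ + escK u₁ v₁ P₁`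
(`P_i B = B P_iᵀ`, the lines are `B`-orthogonal: `P_i B P_jᵀ = P_i P_j B`). -/
theorem torusMatK_mul_B_mul_transpose {d : k} (hΩ : W.Ω * W.Ω = -(d • (1 : Matrix (Fin 4) (Fin 4) k)))
    (hΩB : W.Ω * W.B = -(W.B * W.Ωᵀ)) (P : Fin 2 → Matrix (Fin 4) (Fin 4) k)
    (hPΩ : ∀ i, P i * W.Ω = W.Ω * P i) (hPB : ∀ i, P i * W.B = W.B * (P i)ᵀ) (hPi : ∀ i, P i * P i = P i)
    (hPs : P 0 + P 1 = 1) (u v : Fin 2 → k) (hn : ∀ i, nrmK d (u i) (v i) = 1) :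
    torusMatK W P u v * W.B * (torusMatK W P u v)ᵀ = W.B := by
  have h01 : P 0 * P 1 = 0 := mul_eq_zero_of_ne P hPi hPs (by decide)
  have h10 : P 1 * P 0 = 0 := mul_eq_zero_of_ne P hPi hPs (by decide)
  -- `P_i B P_jᵀ = P_i P_j B`
  have hPBP : ∀ i j, P i * W.B * (P j)ᵀ = P i * P j * W.B := by
    intro i j
    rw [Matrix.mul_assoc, ← hPB j, ← Matrix.mul_assoc]
  -- the scalar on line `i` is unitary: `e_i B e_iᵀ = B`
  have hsc : ∀ i, escK W (u i) (v i) * W.B * (escK W (u i) (v i))ᵀ = W.B := by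
    intro i
    rw [escK_mul_B_mul_transpose W hΩ hΩB, hn i, one_smul]
  -- the scalars commute with the projectors
  have hcomm : ∀ x y i, escK W x y * P i = P i * escK W x y := fun x y i => escK_mul_comm W x y (hPΩ i)
  -- expand
  simp only [torusMatK, transpose_add, transpose_mul, add_mul, mul_add]
  -- each term `e_i P_i B P_jᵀ e_jᵀ = e_i (P_i P_j B) e_jᵀ`
  have key : ∀ i j, escK W (u i) (v i) * P i * W.B * ((P j)ᵀ * (escK W (u j) (v j))ᵀ) =
      if i = j then P i * W.B else 0 := by
    intro i j
    have e1 : escK W (u i) (v i) * P i * W.B * ((P j)ᵀ * (escK W (u j) (v j))ᵀ) =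
        escK W (u i) (v i) * (P i * P j * W.B) * (escK W (u j) (v j))ᵀ := by
      rw [← hPBP i j]; simp only [Matrix.mul_assoc]
    rw [e1]
    by_cases hij : i = j
    · subst hij
      rw [hPi i, if_pos rfl]
      calc escK W (u i) (v i) * (P i * W.B) * (escK W (u i) (v i))ᵀ
          = escK W (u i) (v i) * P i * W.B * (escK W (u i) (v i))ᵀ := by simp only [Matrix.mul_assoc]
        _ = P i * (escK W (u i) (v i) * W.B * (escK W (u i) (v i))ᵀ) := by
            rw [hcomm]; simp only [Matrix.mul_assoc]
        _ = P i * W.B := by rw [hsc i]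
    · rw [if_neg hij]
      have h0 : P i * P j = 0 := by
        fin_cases i <;> fin_cases j <;> simp_all
      rw [h0, Matrix.zero_mul, Matrix.mul_zero, Matrix.zero_mul]
  rw [key 0 0, key 0 1, key 1 0, key 1 1]
  simp only [if_true, Fin.zero_eq_one_iff, OfNat.ofNat_ne_one, if_false, Fin.one_eq_zero_iff, add_zero, zero_add]
  rw [← add_mul, hPs, Matrix.one_mul]

/-- the conjugate torus element is a two-sided inverse when the scalars have norm one -/
theorem torusMatK_mul_conj {d : k} (hΩ : W.Ω * W.Ω = -(d • (1 : Matrix (Fin 4) (Fin 4) k)))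
    (P : Fin 2 → Matrix (Fin 4) (Fin 4) k) (hPΩ : ∀ i, P i * W.Ω = W.Ω * P i) (hPi : ∀ i, P i * P i = P i)
    (hPs : P 0 + P 1 = 1) (u v : Fin 2 → k) (hn : ∀ i, nrmK d (u i) (v i) = 1) :
    torusMatK W P u v * torusMatK W P u (fun i => -v i) = 1 := by
  have h01 : P 0 * P 1 = 0 := mul_eq_zero_of_ne P hPi hPs (by decide)
  have h10 : P 1 * P 0 = 0 := mul_eq_zero_of_ne P hPi hPs (by decide)
  have hcomm : ∀ x y i, escK W x y * P i = P i * escK W x y := fun x y i => escK_mul_comm W x y (hPΩ i)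
  have hc : ∀ i, escK W (u i) (v i) * escK W (u i) (-v i) = 1 := by
    intro i
    rw [escK_mul_escK_conj W hΩ, hn i, one_smul]
  simp only [torusMatK, add_mul, mul_add]
  have key : ∀ i j, escK W (u i) (v i) * P i * (escK W (u j) (-v j) * P j) = if i = j then P i else 0 := by
    intro i j
    have e1 : escK W (u i) (v i) * P i * (escK W (u j) (-v j) * P j) =
        escK W (u i) (v i) * escK W (u j) (-v j) * (P i * P j) := by
      calc escK W (u i) (v i) * P i * (escK W (u j) (-v j) * P j)
          = escK W (u i) (v i) * (P i * escK W (u j) (-v j)) * P j := by simp only [Matrix.mul_assoc]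
        _ = escK W (u i) (v i) * (escK W (u j) (-v j) * P i) * P j := by rw [hcomm]
        _ = escK W (u i) (v i) * escK W (u j) (-v j) * (P i * P j) := by simp only [Matrix.mul_assoc]
    rw [e1]
    by_cases hij : i = j
    · subst hij
      rw [hc i, Matrix.one_mul, hPi i, if_pos rfl]
    · rw [if_neg hij]
      have h0 : P i * P j = 0 := by
        fin_cases i <;> fin_cases j <;> simp_all
      rw [h0, Matrix.mul_zero]
  rw [key 0 0, key 0 1, key 1 0, key 1 1]
  simp only [if_true, Fin.zero_eq_one_iff, OfNat.ofNat_ne_one, if_false, Fin.one_eq_zero_iff, add_zero, zero_add]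
  exact hPs

/-- a torus element with norm-one scalars has non-zero determinant -/
theorem torusMatK_det_ne_zero {d : k} (hΩ : W.Ω * W.Ω = -(d • (1 : Matrix (Fin 4) (Fin 4) k)))
    (P : Fin 2 → Matrix (Fin 4) (Fin 4) k) (hPΩ : ∀ i, P i * W.Ω = W.Ω * P i) (hPi : ∀ i, P i * P i = P i)
    (hPs : P 0 + P 1 = 1) (u v : Fin 2 → k) (hn : ∀ i, nrmK d (u i) (v i) = 1) :
    (torusMatK W P u v).det ≠ 0 := by
  have h := torusMatK_mul_conj W hΩ P hPΩ hPi hPs u v hn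
  intro h0
  have := congrArg Matrix.det h
  rw [det_mul, h0, zero_mul, det_one] at this
  exact zero_ne_one this

end Torus

/-! ## 3. The rational torus POINTS -/

section Points

variable {k : Type} [Field k] [NumberField k] (W : PlaneData k)

/-- `adMat` of a rational scalar is the adelic scalar of the images -/
theorem adMat_escK (x y : k) : adMat k (escK W x y) = esc W (algebraMap k (Ad k) x) (algebraMap k (Ad k) y) := by
  ext i j
  simp only [escK, esc, adMat, Matrix.map_apply, Matrix.add_apply, Matrix.smul_apply, Matrix.one_apply, smul_eq_mul,
    map_add, map_mul]
  split_ifs <;> simp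

/-- **the rational torus point** with scalars `u_i + v_i Ω` (of norm one) on the lines of a complementary pair of
`B`-self-adjoint `E′`-line projectors. -/
def torusPtK {d : k} (hΩ : W.Ω * W.Ω = -(d • (1 : Matrix (Fin 4) (Fin 4) k)))
    (hΩB : W.Ω * W.B = -(W.B * W.Ωᵀ)) (P : Fin 2 → Matrix (Fin 4) (Fin 4) k)
    (hPΩ : ∀ i, P i * W.Ω = W.Ω * P i) (hPB : ∀ i, P i * W.B = W.B * (P i)ᵀ) (hPi : ∀ i, P i * P i = P i)
    (hPs : P 0 + P 1 = 1) (u v : Fin 2 → k) (hn : ∀ i, nrmK d (u i) (v i) = 1) : GA W :=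
  GA.ofRationalMat W (torusMatK W P u v) (torusMatK_det_ne_zero W hΩ P hPΩ hPi hPs u v hn)
    (torusMatK_mul_Omega W P hPΩ u v) (torusMatK_mul_B_mul_transpose W hΩ hΩB P hPΩ hPB hPi hPs u v hn)

/-- the matrix of the torus point -/
theorem mat_torusPtK {d : k} (hΩ : W.Ω * W.Ω = -(d • (1 : Matrix (Fin 4) (Fin 4) k)))
    (hΩB : W.Ω * W.B = -(W.B * W.Ωᵀ)) (P : Fin 2 → Matrix (Fin 4) (Fin 4) k)
    (hPΩ : ∀ i, P i * W.Ω = W.Ω * P i) (hPB : ∀ i, P i * W.B = W.B * (P i)ᵀ) (hPi : ∀ i, P i * P i = P i)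
    (hPs : P 0 + P 1 = 1) (u v : Fin 2 → k) (hn : ∀ i, nrmK d (u i) (v i) = 1) :
    GA.mat W (torusPtK W hΩ hΩB P hPΩ hPB hPi hPs u v hn) = adMat k (torusMatK W P u v) := rfl

/-- the torus point is a rational point -/
theorem torusPtK_mem_rationalPoints {d : k} (hΩ : W.Ω * W.Ω = -(d • (1 : Matrix (Fin 4) (Fin 4) k)))
    (hΩB : W.Ω * W.B = -(W.B * W.Ωᵀ)) (P : Fin 2 → Matrix (Fin 4) (Fin 4) k)
    (hPΩ : ∀ i, P i * W.Ω = W.Ω * P i) (hPB : ∀ i, P i * W.B = W.B * (P i)ᵀ) (hPi : ∀ i, P i * P i = P i)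
    (hPs : P 0 + P 1 = 1) (u v : Fin 2 → k) (hn : ∀ i, nrmK d (u i) (v i) = 1) :
    torusPtK W hΩ hΩB P hPΩ hPB hPi hPs u v hn ∈ rationalPoints W :=
  GA.ofRationalMat_mem_rationalPoints W _ _ _ _

/-- the torus point commutes with each projector (as an adelic point) -/
theorem torusPtK_mem_commutant {d : k} (hΩ : W.Ω * W.Ω = -(d • (1 : Matrix (Fin 4) (Fin 4) k)))
    (hΩB : W.Ω * W.B = -(W.B * W.Ωᵀ)) (P : Fin 2 → Matrix (Fin 4) (Fin 4) k)
    (hPΩ : ∀ i, P i * W.Ω = W.Ω * P i) (hPB : ∀ i, P i * W.B = W.B * (P i)ᵀ) (hPi : ∀ i, P i * P i = P i)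
    (hPs : P 0 + P 1 = 1) (u v : Fin 2 → k) (hn : ∀ i, nrmK d (u i) (v i) = 1) (i : Fin 2) :
    torusPtK W hΩ hΩB P hPΩ hPB hPi hPs u v hn ∈ commutant W (P i) := by
  change GA.mat W (torusPtK W hΩ hΩB P hPΩ hPB hPi hPs u v hn) * adMat k (P i) =
    adMat k (P i) * GA.mat W (torusPtK W hΩ hΩB P hPΩ hPB hPi hPs u v hn)
  rw [mat_torusPtK, ← adMat_mul, ← adMat_mul, torusMatK_mul_P W P hPΩ hPi hPs u v i]

/-- the torus point of the `P`-lines lies in `T` -/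
theorem torusPtK_mem_torusT {d : k} (hΩ : W.Ω * W.Ω = -(d • (1 : Matrix (Fin 4) (Fin 4) k)))
    (hΩB : W.Ω * W.B = -(W.B * W.Ωᵀ)) (hPB : ∀ i, W.P i * W.B = W.B * (W.P i)ᵀ) (u v : Fin 2 → k)
    (hn : ∀ i, nrmK d (u i) (v i) = 1) :
    torusPtK W hΩ hΩB W.P W.P_comm hPB W.P_idem W.P_sum u v hn ∈ torusT W :=
  Subgroup.mem_inf.2 ⟨torusPtK_mem_commutant W hΩ hΩB W.P W.P_comm hPB W.P_idem W.P_sum u v hn 0,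
    torusPtK_mem_commutant W hΩ hΩB W.P W.P_comm hPB W.P_idem W.P_sum u v hn 1⟩

/-- the torus point of the `Q`-lines lies in `T′` -/
theorem torusPtK_mem_torusT' {d : k} (hΩ : W.Ω * W.Ω = -(d • (1 : Matrix (Fin 4) (Fin 4) k)))
    (hΩB : W.Ω * W.B = -(W.B * W.Ωᵀ)) (hQB : ∀ j, W.Q j * W.B = W.B * (W.Q j)ᵀ) (u v : Fin 2 → k)
    (hn : ∀ j, nrmK d (u j) (v j) = 1) :
    torusPtK W hΩ hΩB W.Q W.Q_comm hQB W.Q_idem W.Q_sum u v hn ∈ torusT' W :=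
  Subgroup.mem_inf.2 ⟨torusPtK_mem_commutant W hΩ hΩB W.Q W.Q_comm hQB W.Q_idem W.Q_sum u v hn 0,
    torusPtK_mem_commutant W hΩ hΩB W.Q W.Q_comm hQB W.Q_idem W.Q_sum u v hn 1⟩

end Points

end Summit.Ventures.HodgeRepro.Tier4.Line4

end
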